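import Summits.Ventures.PackingBounds.ThreePointCert.CheckFKSSound

/-!
# Kronecker-substitution validation of Gram expansions over POLYNOMIAL bases

Framing: lottery ticket; floor = certified bounds/negative ranges. Venture `PackingBounds`
(cell `pub-packcert`), three-point SDP family — kernel-checking infrastructure.

`ThreePointCert.CheckKS` validates `R = Σ_k (Σ_j (e_{kj} − B) z_{k+j})²` for a MONOMIAL basis `z`.
The certificates' sums-of-squares multipliers are block-diagonalised by symmetry (S₃ / S₂ isotypic
parts: bases of orbit sums, alternating sums and the two standard components — short integer
polynomials), and re-combining the parts into one dense monomial-basis Gram matrix costs a factor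
≈ 3–4 in factor data (lp gen 8 §4). Here the basis is a list of short term lists `vs`; at the
Kronecker point each basis polynomial is ONE integer (`encZ`), so the kernel cost per factor entry is
again one big-integer multiply–add (`sosCheckKSP`), and the soundness argument of `CheckKS` goes
through verbatim with `colPolyP = Σ_j (e_j − B) • p_j` (`boxNonneg_of_sosCheckKSP`). The earlier
polynomial-basis attempt `CheckKronP` (per-pair polynomial products merged term by term) was not
competitive in the kernel; this one has no per-pair work. No statement about certificates changes.
-/

noncomputable section

namespace Summit.Ventures.PackingBounds.ThreePointCert

open Literature.Geometry.DiscreteGeometry Literature.Geometry.DiscreteGeometry.PolyCert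
open Literature.Geometry.DiscreteGeometry.PolyCert.SPoly

/-! ### Kernel programs -/

/-- Signed value of a term list at the Kronecker point. -/
def encZ (w D : ℕ) (p : SPoly) : ℤ := Int.subNatNat (encP w D p) (encN w D p)

/-- Values of the basis polynomials at the Kronecker point. -/
def encBasis (w D : ℕ) (vs : List SPoly) : List ℤ := vs.map (encZ w D)

/-- `acc + Σ_j e_j · q_j` over the common prefix of entries and basis values. -/
def colPZ (es : List ℕ) : List ℤ → ℤ → ℤ :=
  es.rec (motive := fun _ => List ℤ → ℤ → ℤ) (fun _ acc => acc)
    (fun e _ ih qs acc => qs.casesOn (motive := fun _ => ℤ) acc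
      (fun q qs' => ih qs' (Int.add acc (Int.mul (Int.ofNat e) q))))

/-- `acc + Σ_j q_j` over the common prefix. -/
def colXZ (es : List ℕ) : List ℤ → ℤ → ℤ :=
  es.rec (motive := fun _ => List ℤ → ℤ → ℤ) (fun _ acc => acc)
    (fun _ _ ih qs acc => qs.casesOn (motive := fun _ => ℤ) acc
      (fun q qs' => ih qs' (Int.add acc q)))

/-- Value of one offset-encoded column `Σ_j (e_j − B) p_j` at the Kronecker point. -/
def colValKSP (B : ℕ) (es : List ℕ) (qs : List ℤ) : ℤ :=
  Int.sub (colPZ es qs 0) (Int.mul (Int.ofNat B) (colXZ es qs 0))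

/-- `Σ_k col_k²` at the Kronecker point, column `k` against the basis suffix from `k`. -/
def sosValKSP (B : ℕ) (cols : List (List ℕ)) : List ℤ → ℤ :=
  cols.rec (motive := fun _ => List ℤ → ℤ) (fun _ => 0)
    (fun es _ ih qs => Int.add (sqZ (colValKSP B es qs)) (ih qs.tail))

/-- Doubled exponents of every monomial of every basis polynomial are `< D`. -/
def basisOKP (D : ℕ) (vs : List SPoly) : Bool :=
  vs.all fun p => p.all fun mc => Nat.blt (2 * mc.1.a) D && Nat.blt (2 * mc.1.b) D && Nat.blt (2 * mc.1.c) D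

/-- The largest absolute coefficient sum of a basis polynomial. -/
def basisAbs (vs : List SPoly) : ℕ := (vs.map absSum).foldr max 0

/-- **The Kronecker-substitution SOS check over a polynomial basis.** Data: width `w`, base `D`,
offset `B`, digit bound `Dg`, basis `vs` (its Kronecker values are computed once by the kernel),
offset-encoded columns, claimed expansion `R`. -/
def sosCheckKSP (w D B Dg : ℕ) (vs : List SPoly) (cols : List (List ℕ)) (R : SPoly) : Bool :=
  basisOKP D vs && boxOK D R && decide (B ≤ Dg) && cols.all (digitsOK Dg) &&
    decide (2 * (absSum R + Dg * Dg * (basisAbs vs * basisAbs vs) * lenSqSum cols) < 2 ^ w) &&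
    decide (encZ w D R = sosValKSP B cols (encBasis w D vs))

/-! ### Meaning of the programs -/

/-- The column polynomial `Σ_j (e_j − B) • p_j` (zipped over the common prefix). -/
def colPolyP (B : ℕ) : List ℕ → List SPoly → SPoly
  | e :: es, p :: ps => smul ((e : ℤ) - B) p ++ colPolyP B es ps
  | _, _ => []

/-- The sums-of-squares polynomial over the basis suffixes. -/
def sosPolyP (B : ℕ) : List (List ℕ) → List SPoly → SPoly
  | es :: cols, vs => mul (colPolyP B es vs) (colPolyP B es vs) ++ sosPolyP B cols vs.tail
  | [], _ => []

/-- `Σ_j e_j q_j` (zipped). -/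
def colPsemZ : List ℕ → List ℤ → ℤ
  | e :: es, q :: qs => (e : ℤ) * q + colPsemZ es qs
  | _, _ => 0

/-- `Σ_j q_j` over the zipped prefix. -/
def colXsemZ : List ℕ → List ℤ → ℤ
  | _ :: es, q :: qs => q + colXsemZ es qs
  | _, _ => 0

/-- Accumulator law of `colPZ`. -/
theorem colPZ_eq : ∀ (es : List ℕ) (qs : List ℤ) (acc : ℤ), colPZ es qs acc = acc + colPsemZ es qs
  | [], qs, acc => by cases qs <;> simp [colPZ, colPsemZ]
  | e :: es, [], acc => by simp [colPZ, colPsemZ]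
  | e :: es, q :: qs, acc => by
    show colPZ es qs (Int.add acc (Int.mul (Int.ofNat e) q)) = acc + ((e : ℤ) * q + colPsemZ es qs)
    rw [colPZ_eq es qs]
    show acc + (e : ℤ) * q + colPsemZ es qs = _
    ring

/-- Accumulator law of `colXZ`. -/
theorem colXZ_eq : ∀ (es : List ℕ) (qs : List ℤ) (acc : ℤ), colXZ es qs acc = acc + colXsemZ es qs
  | [], qs, acc => by cases qs <;> simp [colXZ, colXsemZ]
  | e :: es, [], acc => by simp [colXZ, colXsemZ]
  | e :: es, q :: qs, acc => by
    show colXZ es qs (Int.add acc q) = acc + (q + colXsemZ es qs)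
    rw [colXZ_eq es qs]
    show acc + q + colXsemZ es qs = _
    ring

/-- `encZ` is the value at the Kronecker point. -/
theorem encZ_eq (w D : ℕ) (p : SPoly) : encZ w D p = evalZ p (2 ^ w) (2 ^ (w * D)) (2 ^ (w * D * D)) :=
  enc_eq w D p

/-- The column polynomial at the Kronecker point. -/
theorem evalZ_colPolyP (w D B : ℕ) : ∀ (es : List ℕ) (vs : List SPoly),
    evalZ (colPolyP B es vs) (2 ^ w) (2 ^ (w * D)) (2 ^ (w * D * D)) =
      colPsemZ es (encBasis w D vs) - B * colXsemZ es (encBasis w D vs)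
  | [], vs => by cases vs <;> simp [colPolyP, colPsemZ, colXsemZ]
  | e :: es, [] => by simp [colPolyP, colPsemZ, colXsemZ, encBasis]
  | e :: es, p :: vs => by
    have ih := evalZ_colPolyP w D B es vs
    simp only [encBasis, List.map_cons] at ih ⊢
    rw [colPolyP, evalZ_append, evalZ_smul, ih, colPsemZ, colXsemZ, encZ_eq]
    ring

/-- The column value program computes the column polynomial at the Kronecker point. -/
theorem colValKSP_eq (w D B : ℕ) (es : List ℕ) (vs : List SPoly) :
    colValKSP B es (encBasis w D vs) =
      evalZ (colPolyP B es vs) (2 ^ w) (2 ^ (w * D)) (2 ^ (w * D * D)) := by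
  rw [evalZ_colPolyP, colValKSP, colPZ_eq, colXZ_eq]
  show (0 + colPsemZ es (encBasis w D vs)) - (B : ℤ) * (0 + colXsemZ es (encBasis w D vs)) = _
  ring

/-- `encBasis` of a tail. -/
theorem encBasis_tail (w D : ℕ) (vs : List SPoly) : (encBasis w D vs).tail = encBasis w D vs.tail := by
  cases vs <;> rfl

/-- The SOS value program computes the SOS polynomial at the Kronecker point. -/
theorem sosValKSP_eq (w D B : ℕ) : ∀ (cols : List (List ℕ)) (vs : List SPoly),
    sosValKSP B cols (encBasis w D vs) =
      evalZ (sosPolyP B cols vs) (2 ^ w) (2 ^ (w * D)) (2 ^ (w * D * D))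
  | [], vs => by simp [sosValKSP, sosPolyP]
  | es :: cols, vs => by
    have ih := sosValKSP_eq w D B cols vs.tail
    rw [sosPolyP, evalZ_append, evalZ_mul, ← colValKSP_eq, ← ih, ← encBasis_tail]
    rfl

/-! ### Nonnegativity, coefficient and exponent bounds -/

/-- The SOS polynomial is a sum of squares. -/
theorem eval_sosPolyP_nonneg (B : ℕ) : ∀ (cols : List (List ℕ)) (vs : List SPoly) (u v t : ℝ),
    0 ≤ eval (sosPolyP B cols vs) u v t
  | [], vs, u, v, t => by simp [sosPolyP]
  | es :: cols, vs, u, v, t => by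
    rw [sosPolyP, eval_append, eval_mul]
    exact add_nonneg (mul_self_nonneg _) (eval_sosPolyP_nonneg B cols vs.tail u v t)

/-- Every basis polynomial has `absSum ≤ basisAbs`. -/
theorem absSum_le_basisAbs : ∀ (vs : List SPoly) (p : SPoly), p ∈ vs → absSum p ≤ basisAbs vs
  | [], p, h => by simp at h
  | q :: vs, p, h => by
    simp only [basisAbs, List.map_cons, List.foldr_cons] at *
    rcases List.mem_cons.1 h with rfl | h
    · exact le_max_left _ _
    · exact (absSum_le_basisAbs vs p h).trans (le_max_right _ _)

/-- `basisAbs` of a tail. -/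
theorem basisAbs_tail_le (vs : List SPoly) : basisAbs vs.tail ≤ basisAbs vs := by
  cases vs with
  | nil => exact le_rfl
  | cons p vs => simp only [basisAbs, List.tail_cons, List.map_cons, List.foldr_cons]; exact le_max_right _ _

/-- Coefficient bound of a column: `absSum ≤ |es| · Dg · basisAbs`. -/
theorem absSum_colPolyP (B Dg : ℕ) (hB : B ≤ Dg) : ∀ (es : List ℕ) (vs : List SPoly),
    digitsOK Dg es = true → absSum (colPolyP B es vs) ≤ es.length * Dg * basisAbs vs
  | [], vs, _ => by cases vs <;> simp [colPolyP, absSum]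
  | e :: es, [], _ => by simp [colPolyP, absSum]
  | e :: es, p :: vs, h => by
    have h' : e < Dg ∧ digitsOK Dg es = true := by
      have : (Nat.blt e Dg && digitsOK Dg es) = true := h
      simpa [Nat.blt_eq] using this
    have ih := absSum_colPolyP B Dg hB es vs h'.2
    have hp : absSum p ≤ basisAbs (p :: vs) := absSum_le_basisAbs _ p (by simp)
    have ht : basisAbs vs ≤ basisAbs (p :: vs) := basisAbs_tail_le (p :: vs)
    rw [colPolyP, absSum_append, absSum_smul, List.length_cons]
    have h1 : ((e : ℤ) - B).natAbs ≤ Dg := by omega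
    have h2 : ((e : ℤ) - B).natAbs * absSum p ≤ Dg * basisAbs (p :: vs) := Nat.mul_le_mul h1 hp
    have h3 : es.length * Dg * basisAbs vs ≤ es.length * Dg * basisAbs (p :: vs) := Nat.mul_le_mul_left _ ht
    nlinarith

/-- Coefficient bound of the SOS polynomial. -/
theorem absSum_sosPolyP (B Dg : ℕ) (hB : B ≤ Dg) : ∀ (cols : List (List ℕ)) (vs : List SPoly),
    cols.all (digitsOK Dg) = true →
      absSum (sosPolyP B cols vs) ≤ Dg * Dg * (basisAbs vs * basisAbs vs) * lenSqSum cols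
  | [], vs, _ => by simp [sosPolyP, absSum]
  | es :: cols, vs, h => by
    rw [List.all_cons, Bool.and_eq_true] at h
    have h1 := absSum_colPolyP B Dg hB es vs h.1
    have ih := absSum_sosPolyP B Dg hB cols vs.tail h.2
    have ht := basisAbs_tail_le vs
    have ih' : absSum (sosPolyP B cols vs.tail) ≤ Dg * Dg * (basisAbs vs * basisAbs vs) * lenSqSum cols :=
      ih.trans (Nat.mul_le_mul_right _ (Nat.mul_le_mul_left _ (Nat.mul_le_mul ht ht)))
    rw [sosPolyP, absSum_append, absSum_mul]
    simp only [lenSqSum, List.map_cons, List.sum_cons] at ih' ⊢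
    nlinarith [Nat.zero_le (absSum (colPolyP B es vs))]

/-- Monomials of a column come from the basis polynomials. -/
theorem mem_colPolyP (B : ℕ) : ∀ (es : List ℕ) (vs : List SPoly) (mc : Mono × ℤ),
    mc ∈ colPolyP B es vs → ∃ p ∈ vs, ∃ nc ∈ p, mc.1 = nc.1
  | [], vs, mc, h => by cases vs <;> simp [colPolyP] at h
  | e :: es, [], mc, h => by simp [colPolyP] at h
  | e :: es, p :: vs, mc, h => by
    rw [colPolyP, List.mem_append] at h
    rcases h with h | h
    · simp only [smul, List.mem_map] at h
      obtain ⟨nc, hnc, rfl⟩ := h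
      exact ⟨p, by simp, nc, hnc, rfl⟩
    · obtain ⟨p', hp', nc, hnc, e'⟩ := mem_colPolyP B es vs mc h
      exact ⟨p', by simp [hp'], nc, hnc, e'⟩

/-- Unpacked `basisOKP`. -/
theorem basisOKP_spec (D : ℕ) (vs : List SPoly) (h : basisOKP D vs = true) (p : SPoly) (hp : p ∈ vs)
    (nc : Mono × ℤ) (hnc : nc ∈ p) : 2 * nc.1.a < D ∧ 2 * nc.1.b < D ∧ 2 * nc.1.c < D := by
  simp only [basisOKP, List.all_eq_true, Bool.and_eq_true, Nat.blt_eq] at h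
  have := h p hp nc hnc
  exact ⟨this.1.1, this.1.2, this.2⟩

/-- `basisOKP` passes to the tail. -/
theorem basisOKP_tail (D : ℕ) (vs : List SPoly) (h : basisOKP D vs = true) : basisOKP D vs.tail = true := by
  cases vs with
  | nil => exact h
  | cons p vs => simp only [basisOKP, List.all_cons, Bool.and_eq_true] at h ⊢; exact h.2

/-- Exponents of the SOS polynomial stay in the box. -/
theorem inBox_sosPolyP (B D : ℕ) : ∀ (cols : List (List ℕ)) (vs : List SPoly), basisOKP D vs = true →
    ∀ mc ∈ sosPolyP B cols vs, mc.1.a < D ∧ mc.1.b < D ∧ mc.1.c < D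
  | [], vs, _, mc, h => by simp [sosPolyP] at h
  | es :: cols, vs, hv, mc, h => by
    rw [sosPolyP, List.mem_append] at h
    rcases h with h | h
    · obtain ⟨a, ha, b, hb, e⟩ := mem_mul _ _ mc h
      obtain ⟨pa, hpa, na, hna, ea⟩ := mem_colPolyP B es vs a ha
      obtain ⟨pb, hpb, nb, hnb, eb⟩ := mem_colPolyP B es vs b hb
      have h1 := basisOKP_spec D vs hv pa hpa na hna
      have h2 := basisOKP_spec D vs hv pb hpb nb hnb
      rw [e, ea, eb]; simp only [Mono.mul]; omega
    · exact inBox_sosPolyP B D cols vs.tail (basisOKP_tail D vs hv) mc h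

/-! ### Soundness -/

/-- **Soundness of the polynomial-basis Kronecker-substitution SOS check**: the claimed expansion
equals `Σ_k col_k²` as a function. -/
theorem eval_eq_sos_of_sosCheckKSP (w D B Dg : ℕ) (vs : List SPoly)
    (cols : List (List ℕ)) (R : SPoly) (h : sosCheckKSP w D B Dg vs cols R = true) (u v t : ℝ) :
    eval R u v t = eval (sosPolyP B cols vs) u v t := by
  unfold sosCheckKSP at h
  simp only [Bool.and_eq_true, decide_eq_true_eq] at h
  obtain ⟨⟨⟨⟨⟨hv, hR⟩, hB⟩, hdig⟩, hw⟩, hval⟩ := h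
  rw [encZ_eq, sosValKSP_eq] at hval
  have hQ := eval_eq_zero_of_kronecker w D (sosPolyP B cols vs ++ neg R)
    (fun mc hmc => by
      rcases List.mem_append.1 hmc with h | h
      · exact inBox_sosPolyP B D cols vs hv mc h
      · exact inBox_neg D R hR mc h)
    (by
      rw [absSum_append, absSum_neg]
      have := absSum_sosPolyP B Dg hB cols vs hdig
      omega)
    (by rw [evalZ_append, evalZ_neg, ← hval]; ring) u v t
  rw [eval_append, eval_neg] at hQ
  linarith

/-- **Box-nonnegativity from the polynomial-basis check** (the form consumed by `SoundNN.PolysNN3`;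
parts of one multiplier are concatenated with `boxNonneg_append`, scaled with `boxNonneg_smul`). -/
theorem boxNonneg_of_sosCheckKSP (w D B Dg : ℕ) (vs : List SPoly) (cols : List (List ℕ))
    (R : SPoly) (h : sosCheckKSP w D B Dg vs cols R = true) : BoxNonneg R :=
  fun u v t _ _ _ => by
    rw [eval_eq_sos_of_sosCheckKSP w D B Dg vs cols R h]; exact eval_sosPolyP_nonneg B cols vs u v t


/-! ### Several parts with a common scale (all isotypic components of one multiplier) -/

/-- One symmetry-adapted part of a Gram expansion: offset `B`, digit bound `Dg`, polynomial basis
`vs`, offset-encoded factor columns. -/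
structure KSPart where
  /-- offset of the stored entries -/
  B : ℕ
  /-- digit bound (`B ≤ Dg`, entries `< Dg`) -/
  Dg : ℕ
  /-- basis polynomials -/
  vs : List SPoly
  /-- factor columns, column `k` against the basis suffix from `k` -/
  cols : List (List ℕ)

/-- Side conditions of one part. -/
def KSPart.ok (D : ℕ) (P : KSPart) : Bool :=
  basisOKP D P.vs && decide (P.B ≤ P.Dg) && P.cols.all (digitsOK P.Dg)

/-- Coefficient bound of one part. -/
def KSPart.bound (P : KSPart) : ℕ := P.Dg * P.Dg * (basisAbs P.vs * basisAbs P.vs) * lenSqSum P.cols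

/-- Value of one part at the Kronecker point (basis values computed by the kernel). -/
def KSPart.val (w D : ℕ) (P : KSPart) : ℤ := sosValKSP P.B P.cols (encBasis w D P.vs)

/-- Sum of the part values. -/
def partsVal (w D : ℕ) : List KSPart → ℤ
  | [] => 0
  | P :: Ps => P.val w D + partsVal w D Ps

/-- Sum of the part bounds. -/
def partsBound : List KSPart → ℕ
  | [] => 0
  | P :: Ps => P.bound + partsBound Ps

/-- **Kronecker-substitution SOS check of a multiplier given by several parts with a common scale
`c`**: `R = c • Σ_parts Σ_k col_k²`. -/
def sosCheckKSParts (w D c : ℕ) (Ps : List KSPart) (R : SPoly) : Bool :=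
  Ps.all (KSPart.ok D) && boxOK D R && decide (2 * (absSum R + c * partsBound Ps) < 2 ^ w) &&
    decide (encZ w D R = (c : ℤ) * partsVal w D Ps)

/-- The sum of the parts' SOS polynomials. -/
def partsPoly : List KSPart → SPoly
  | [] => []
  | P :: Ps => sosPolyP P.B P.cols P.vs ++ partsPoly Ps

/-- The parts' SOS sum is nonnegative. -/
theorem eval_partsPoly_nonneg (u v t : ℝ) : ∀ Ps : List KSPart, 0 ≤ eval (partsPoly Ps) u v t
  | [] => by simp [partsPoly]
  | P :: Ps => by
    rw [partsPoly, eval_append]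
    exact add_nonneg (eval_sosPolyP_nonneg P.B P.cols P.vs u v t) (eval_partsPoly_nonneg u v t Ps)

/-- Value, coefficient bound and exponent box of the parts' sum under the side conditions. -/
theorem partsPoly_spec (w D : ℕ) : ∀ Ps : List KSPart, Ps.all (KSPart.ok D) = true →
    evalZ (partsPoly Ps) (2 ^ w) (2 ^ (w * D)) (2 ^ (w * D * D)) = partsVal w D Ps ∧
      absSum (partsPoly Ps) ≤ partsBound Ps ∧
      ∀ mc ∈ partsPoly Ps, mc.1.a < D ∧ mc.1.b < D ∧ mc.1.c < D
  | [], _ => by simp [partsPoly, partsVal, partsBound, absSum]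
  | P :: Ps, h => by
    rw [List.all_cons, Bool.and_eq_true] at h
    obtain ⟨hP, hPs⟩ := h
    obtain ⟨ih1, ih2, ih3⟩ := partsPoly_spec w D Ps hPs
    unfold KSPart.ok at hP
    simp only [Bool.and_eq_true, decide_eq_true_eq] at hP
    obtain ⟨⟨hv, hB⟩, hdig⟩ := hP
    refine ⟨?_, ?_, ?_⟩
    · rw [partsPoly, evalZ_append, ih1, partsVal, KSPart.val, sosValKSP_eq]
    · rw [partsPoly, absSum_append, partsBound]
      exact Nat.add_le_add ((absSum_sosPolyP P.B P.Dg hB P.cols P.vs hdig).trans_eq rfl) ih2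
    · intro mc hmc
      rw [partsPoly, List.mem_append] at hmc
      rcases hmc with h | h
      · exact inBox_sosPolyP P.B D P.cols P.vs hv mc h
      · exact ih3 mc h

/-- **Soundness of the parts check**: `R = c • Σ_parts Σ_k col_k²` as a function. -/
theorem eval_eq_parts_of_sosCheckKSParts (w D c : ℕ) (Ps : List KSPart) (R : SPoly)
    (h : sosCheckKSParts w D c Ps R = true) (u v t : ℝ) :
    eval R u v t = (c : ℝ) * eval (partsPoly Ps) u v t := by
  unfold sosCheckKSParts at h
  simp only [Bool.and_eq_true, decide_eq_true_eq] at h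
  obtain ⟨⟨⟨hPs, hR⟩, hw⟩, hval⟩ := h
  obtain ⟨e1, e2, e3⟩ := partsPoly_spec w D Ps hPs
  rw [encZ_eq] at hval
  have hQ := eval_eq_zero_of_kronecker w D (smul (c : ℤ) (partsPoly Ps) ++ neg R)
    (fun mc hmc => by
      rcases List.mem_append.1 hmc with h | h
      · simp only [smul, List.mem_map] at h
        obtain ⟨a, ha, rfl⟩ := h
        exact e3 a ha
      · exact inBox_neg D R hR mc h)
    (by
      rw [absSum_append, absSum_neg, absSum_smul, Int.natAbs_natCast]
      have := Nat.mul_le_mul_left c e2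
      omega)
    (by rw [evalZ_append, evalZ_neg, evalZ_smul, e1, ← hval]; ring) u v t
  rw [eval_append, eval_neg, eval_smul, Int.cast_natCast] at hQ
  linarith

/-- **Box-nonnegativity from the parts check.** -/
theorem boxNonneg_of_sosCheckKSParts (w D c : ℕ) (Ps : List KSPart) (R : SPoly)
    (h : sosCheckKSParts w D c Ps R = true) : BoxNonneg R :=
  fun u v t _ _ _ => by
    rw [eval_eq_parts_of_sosCheckKSParts w D c Ps R h]
    exact mul_nonneg (by exact_mod_cast Nat.zero_le c) (eval_partsPoly_nonneg u v t Ps)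

end Summit.Ventures.PackingBounds.ThreePointCert

end
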